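import Mathlib
import HarnessLib

/-!
# Route `KLProgramme` — crux C4a, S3 (B4)-GENERIC — DEFINITION LANE for the MONOTONE-WINDOW CALCULUS («(B4)-GEN-WINDOW»):
# the loop-angle IBP operator `L_g w = (w / g′)′`, the reciprocal-slope jet table, and the graded IBP table

Cell `gate-hubbard-kl`, seat hubbard-kl-k3c3-p3 (g20; row «implicit-function / monotonicity route»).  Located brick for the (C)-closer
lane c4a-1 (stub (C) `stub_twoLeg_curvature` of `KLRegimeEngineV17F2`, stmt-HubbardSuperconductivity-20437), C4A-PLAN §24.4 (iii) / §24.6 (B4) /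
§24.10: in the GENERIC region of the co-moving bubble the loop-angle integral `∫ J(e,φ+θ)·Ψ^{(c)}(ē(e,φ;ρ,ϑ,θ)) dφ` is treated on the windows
around the two crossings where the partner band `g := ē(e,·)` has a slope floor `|∂_φ g| ≥ m > 0`.  On such a window the loop angle is a `C^k`
chart of the partner LEVEL (inverse function), `∂/∂ē` pushes forward to the first-order operator `w ↦ (w/g′)′`, and `c` integrations by parts
move every derivative off `Ψ`:  `∫ w·Ψ^{(c)}(g) dφ = (−1)^c ∫ (L_g^c w)·Ψ(g) dφ` (no boundary terms for `w` supported in the window).  This module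
only NAMES the three objects the identity / bounds files (`…C4aLoopIBP`, `…C4aLoopIBPJets`, `…C4aLoopIBPBounds`) quantify:

* `loopIBPOp g w := (fun s ↦ w s / g′ s)′` — the adjoint of `(1/g′)·∂_φ`, i.e. `∂_φ ∘ (1/g′)`;
* `recipSlopeJet m G k` — the table bounding `|(1/g′)^{(k)}|` on a window with `m ≤ |g′|`, `|g^{(l)}| ≤ G l` (`l ≥ 2`): the IMPLICIT relation
  `(1/g′)·g′ ≡ 1` differentiated `k` times (Leibniz) and solved for the top term gives the recursion
  `R 0 = m⁻¹`, `R k = m⁻¹ · Σ_{j<k} C(k,j) · R j · G (k−j+1)`; closed forms `R 1 = G₂/m²`, `R 2 = G₃/m² + 2G₂²/m³`,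
  `R 3 = G₄/m² + 6G₂G₃/m³ + 6G₂³/m⁴`, `R 4 = G₅/m² + (8G₂G₄ + 6G₃²)/m³ + 36G₂²G₃/m⁴ + 24G₂⁴/m⁵` (= the Faà di Bruno values);
* `loopIBPTable Q W r j` — the table bounding `|(L_g^r w)^{(j)}|` from `|(1/g′)^{(k)}| ≤ Q k`, `|w^{(l)}| ≤ W l`:
  `T 0 j = W j`, `T (r+1) j = Σ_{i ≤ j+1} C(j+1,i) · T r i · Q (j+1−i)` (Leibniz on `(L^r w · (1/g′))^{(j+1)}`).

Definitions + `rfl`/closed-form/nonnegativity lemmas only; no instances, no notation; nothing is asserted about the Hubbard model.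
References: FST II, CPAM 51 (1998) §3 (tangential regularity by integration by parts along the Fermi curve); BGM 2006 §2.4 [cite: BenfattoGiulianiMastropietro2006].
-/

noncomputable section

namespace Summit.HubbardSuperconductivity.HubbardSuperconductivity.Theorems.C4a

set_option linter.dupNamespace false -- summit = problem name (single-conjunct summit), D-0017

open Real Finset

/-- **The loop-angle IBP operator** `L_g w := (w / g′)′` — the formal adjoint of `Ψ(g) ↦ (Ψ(g))′/g′ = Ψ′(g)`: for `w` supported where `g′ ≠ 0`,
`∫ w·Ψ′(g) = −∫ (L_g w)·Ψ(g)` (`…C4aLoopIBP`).  Reading: on a window where `g` is strictly monotone, `φ ↦ g φ` is a chart of the level and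
`L_g` is `∂/∂(level)` transported to the loop angle and transposed. -/
def loopIBPOp (g w : ℝ → ℝ) : ℝ → ℝ := deriv fun s => w s / deriv g s

/-- `loopIBPOp` unfolded. -/
theorem loopIBPOp_def (g w : ℝ → ℝ) : loopIBPOp g w = deriv (fun s => w s / deriv g s) := rfl

/-- The quotient inside `loopIBPOp` is the product with the reciprocal slope. -/
theorem div_deriv_eq_mul_inv (g w : ℝ → ℝ) : (fun s => w s / deriv g s) = fun s => w s * (deriv g s)⁻¹ := by
  funext s; rw [div_eq_mul_inv]

/-- **Reciprocal-slope jet table**: `R 0 = m⁻¹`, `R (k+1) = m⁻¹ · Σ_{j ≤ k} C(k+1,j) · R j · G (k+2−j)` — a bound of `|(1/g′)^{(k)}|` on a window with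
`m ≤ |g′|` and `|g^{(l)}| ≤ G l` (`2 ≤ l`), obtained by solving the `k`-fold Leibniz derivative of the implicit relation `(1/g′)·g′ ≡ 1` for its top term
(`…C4aLoopIBPJets.abs_iteratedDeriv_inv_deriv_le`). -/
def recipSlopeJet (m : ℝ) (G : ℕ → ℝ) : ℕ → ℝ
  | 0 => m⁻¹
  | k + 1 => m⁻¹ * ∑ j : Fin (k + 1), ((k + 1).choose (j : ℕ) : ℝ) * recipSlopeJet m G j * G (k + 2 - j)

/-- `R 0 = m⁻¹`. -/
@[simp] theorem recipSlopeJet_zero (m : ℝ) (G : ℕ → ℝ) : recipSlopeJet m G 0 = m⁻¹ := by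
  rw [recipSlopeJet]

/-- The recursion, `Fin`-sum form. -/
theorem recipSlopeJet_succ (m : ℝ) (G : ℕ → ℝ) (k : ℕ) :
    recipSlopeJet m G (k + 1) = m⁻¹ * ∑ j : Fin (k + 1), ((k + 1).choose (j : ℕ) : ℝ) * recipSlopeJet m G j * G (k + 2 - j) := by
  rw [recipSlopeJet]

/-- The recursion, `Finset.range`-sum form: `R (k+1) = m⁻¹ · Σ_{j < k+1} C(k+1,j) · R j · G (k+2−j)`. -/
theorem recipSlopeJet_succ_range (m : ℝ) (G : ℕ → ℝ) (k : ℕ) :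
    recipSlopeJet m G (k + 1) = m⁻¹ * ∑ j ∈ range (k + 1), ((k + 1).choose j : ℝ) * recipSlopeJet m G j * G (k + 2 - j) := by
  rw [recipSlopeJet_succ, ← Fin.sum_univ_eq_sum_range (fun j => ((k + 1).choose j : ℝ) * recipSlopeJet m G j * G (k + 2 - j))]

/-- Closed form `R 1 = G 2 / m²`. -/
theorem recipSlopeJet_one (m : ℝ) (G : ℕ → ℝ) : recipSlopeJet m G 1 = G 2 / m ^ 2 := by
  rw [recipSlopeJet_succ]; simp; ring

/-- Closed form `R 2 = G 3 / m² + 2 G 2² / m³`. -/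
theorem recipSlopeJet_two (m : ℝ) (G : ℕ → ℝ) : recipSlopeJet m G 2 = G 3 / m ^ 2 + 2 * G 2 ^ 2 / m ^ 3 := by
  rw [recipSlopeJet_succ]; simp [Fin.sum_univ_succ, recipSlopeJet_one]; ring

/-- Closed form `R 3 = G 4 / m² + 6 G 2 G 3 / m³ + 6 G 2³ / m⁴`. -/
theorem recipSlopeJet_three (m : ℝ) (G : ℕ → ℝ) :
    recipSlopeJet m G 3 = G 4 / m ^ 2 + 6 * G 2 * G 3 / m ^ 3 + 6 * G 2 ^ 3 / m ^ 4 := by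
  rw [recipSlopeJet_succ]; simp [Fin.sum_univ_succ, recipSlopeJet_one, recipSlopeJet_two]; ring

/-- Closed form `R 4 = G 5 / m² + (8 G 2 G 4 + 6 G 3²) / m³ + 36 G 2² G 3 / m⁴ + 24 G 2⁴ / m⁵` (the Faà di Bruno value for `1/x ∘ g′`). -/
theorem recipSlopeJet_four (m : ℝ) (G : ℕ → ℝ) :
    recipSlopeJet m G 4 = G 5 / m ^ 2 + (8 * G 2 * G 4 + 6 * G 3 ^ 2) / m ^ 3 + 36 * G 2 ^ 2 * G 3 / m ^ 4 + 24 * G 2 ^ 4 / m ^ 5 := by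
  rw [recipSlopeJet_succ]
  simp [Fin.sum_univ_succ, recipSlopeJet_one, recipSlopeJet_two, recipSlopeJet_three]
  rw [show (Nat.choose 4 2 : ℝ) = 6 by norm_num [Nat.choose]]
  ring

/-- Nonnegativity of the reciprocal-slope table for `0 ≤ m` and `0 ≤ G`. -/
theorem recipSlopeJet_nonneg {m : ℝ} (hm : 0 ≤ m) {G : ℕ → ℝ} (hG : ∀ l, 0 ≤ G l) : ∀ k, 0 ≤ recipSlopeJet m G k := by
  intro k
  induction k using Nat.strong_induction_on with
  | _ k ih =>
    cases k with
    | zero => rw [recipSlopeJet_zero]; exact inv_nonneg.2 hm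
    | succ k =>
      rw [recipSlopeJet_succ]
      refine mul_nonneg (inv_nonneg.2 hm) (Finset.sum_nonneg fun j _ => ?_)
      exact mul_nonneg (mul_nonneg (Nat.cast_nonneg _) (ih j (by omega))) (hG _)

/-- **Graded IBP table**: `T 0 j = W j`, `T (r+1) j = Σ_{i < j+2} C(j+1,i) · T r i · Q (j+1−i)` — a bound of `|(L_g^r w)^{(j)}|` on a window where
`|(1/g′)^{(k)}| ≤ Q k` and `|w^{(l)}| ≤ W l` (`…C4aLoopIBPBounds.abs_iteratedDeriv_iterate_loopIBPOp_le`): `L_g^{r+1} w = (L_g^r w · (1/g′))′`, Leibniz. -/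
def loopIBPTable (Q W : ℕ → ℝ) : ℕ → ℕ → ℝ
  | 0, j => W j
  | r + 1, j => ∑ i ∈ range (j + 2), ((j + 1).choose i : ℝ) * loopIBPTable Q W r i * Q (j + 1 - i)

/-- `T 0 j = W j`. -/
@[simp] theorem loopIBPTable_zero (Q W : ℕ → ℝ) (j : ℕ) : loopIBPTable Q W 0 j = W j := by
  rw [loopIBPTable]

/-- The recursion `T (r+1) j = Σ_{i < j+2} C(j+1,i) · T r i · Q (j+1−i)`. -/
theorem loopIBPTable_succ (Q W : ℕ → ℝ) (r j : ℕ) :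
    loopIBPTable Q W (r + 1) j = ∑ i ∈ range (j + 2), ((j + 1).choose i : ℝ) * loopIBPTable Q W r i * Q (j + 1 - i) := by
  rw [loopIBPTable]

/-- Closed form of the first IBP: `T 1 0 = W 0 · Q 1 + W 1 · Q 0` (`(w/g′)′ = w′/g′ + w·(1/g′)′`). -/
theorem loopIBPTable_one_zero (Q W : ℕ → ℝ) : loopIBPTable Q W 1 0 = W 0 * Q 1 + W 1 * Q 0 := by
  rw [loopIBPTable_succ]
  simp only [Finset.sum_range_succ, Finset.sum_range_zero, loopIBPTable_zero, Nat.choose_zero_right, Nat.choose_self,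
    Nat.cast_one]
  ring

/-- Closed form `T 1 j = Σ_{i < j+2} C(j+1,i) · W i · Q (j+1−i)`. -/
theorem loopIBPTable_one (Q W : ℕ → ℝ) (j : ℕ) :
    loopIBPTable Q W 1 j = ∑ i ∈ range (j + 2), ((j + 1).choose i : ℝ) * W i * Q (j + 1 - i) := by
  rw [loopIBPTable_succ]; simp

/-- Closed form of the second IBP at `j = 0`: `T 2 0 = T 1 0 · Q 1 + T 1 1 · Q 0`
`= (W 0·Q 1 + W 1·Q 0)·Q 1 + (W 0·Q 2 + 2·W 1·Q 1 + W 2·Q 0)·Q 0`. -/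
theorem loopIBPTable_two_zero (Q W : ℕ → ℝ) :
    loopIBPTable Q W 2 0 = (W 0 * Q 1 + W 1 * Q 0) * Q 1 + (W 0 * Q 2 + 2 * W 1 * Q 1 + W 2 * Q 0) * Q 0 := by
  simp only [loopIBPTable_succ, Finset.sum_range_succ, Finset.sum_range_zero, loopIBPTable_zero, Nat.choose_zero_right,
    Nat.choose_self, Nat.cast_one, Nat.cast_ofNat, zero_add, Nat.sub_zero, Nat.sub_self,
    show (2 : ℕ) - 1 = 1 from rfl, show Nat.choose 2 1 = 2 from rfl]
  push_cast
  ring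

/-- Nonnegativity of the graded IBP table for `0 ≤ Q`, `0 ≤ W`. -/
theorem loopIBPTable_nonneg {Q W : ℕ → ℝ} (hQ : ∀ k, 0 ≤ Q k) (hW : ∀ l, 0 ≤ W l) : ∀ r j, 0 ≤ loopIBPTable Q W r j := by
  intro r
  induction r with
  | zero => intro j; rw [loopIBPTable_zero]; exact hW j
  | succ r ih =>
    intro j
    rw [loopIBPTable_succ]
    exact Finset.sum_nonneg fun i _ => mul_nonneg (mul_nonneg (Nat.cast_nonneg _) (ih i)) (hQ _)

/-- Monotonicity of the graded IBP table in both tables (for nonnegative entries). -/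
theorem loopIBPTable_mono {Q Q' W W' : ℕ → ℝ} (hQ : ∀ k, 0 ≤ Q k) (hW : ∀ l, 0 ≤ W l) (hQQ : ∀ k, Q k ≤ Q' k) (hWW : ∀ l, W l ≤ W' l) :
    ∀ r j, loopIBPTable Q W r j ≤ loopIBPTable Q' W' r j := by
  intro r
  induction r with
  | zero => intro j; simp only [loopIBPTable_zero]; exact hWW j
  | succ r ih =>
    intro j
    rw [loopIBPTable_succ, loopIBPTable_succ]
    refine Finset.sum_le_sum fun i _ => ?_
    have h1 := ih i
    have h2 := hQQ (j + 1 - i)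
    have h3 := loopIBPTable_nonneg hQ hW r i
    have h4 := hQ (j + 1 - i)
    have h5 : (0 : ℝ) ≤ ((j + 1).choose i : ℝ) := Nat.cast_nonneg _
    have hT' : 0 ≤ loopIBPTable Q' W' r i := h3.trans h1
    exact mul_le_mul (mul_le_mul_of_nonneg_left h1 h5) h2 h4 (mul_nonneg h5 hT')

end Summit.HubbardSuperconductivity.HubbardSuperconductivity.Theorems.C4a

end
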